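import Summits.CriticalPhenomena.SAWScalingLimit.Theses.SAWExcursionCardy
import Summits.CriticalPhenomena.SAWScalingLimit.Theorems.SAWLoopFugacityFlowSimpleSubseqLimitsBoundaryPassage
import Literature.Probability.LatticeModels.SRWPathSpace
import HarnessLib.Audit

/-!
# Birth skeleton — BOUNDARY child `LatticeBoundaryDecay` of crux `SimpleSubseqLimits`
(route `SAWExcursionCardy`, lattice split of stmt-CriticalPhenomena-4514 by crux strategist r1 [A], 2026-08-17)

LINE `boundary-brownian-domination` — "the self-avoiding walk crawls along `∂Ω` no more than a
random-walk excursion does, and that one does not": the BOUNDARY child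

`LatticeBoundaryDecay := ∀ D a b, IsEndpointApprox D a b → ∀ ρ θ > 0, ∃ ε > 0, ∀ᶠ δ → 0⁺,
   P_δ[some representative visits the open ε-neighbourhood of ∂D at a point ρ-far from a, b] ≤ θ`

from TWO stubs, both stated for the SAME lattice quantity
`rwCollarVisit D δ a_δ b_δ ε' ρ'` = the probability that simple random walk on `ℤ²` started at `a_δ`,
run along the edges of `Ω_δ = discreteDomainGraph D.carrier δ` and stopped at its FIRST arrival at
`b_δ` (the lattice excursion `a_δ → b_δ` of the edge-killed walk, normalised by the arrival
probability — an explicit random-walk quantity, no conformal map), visits on the way a site whose mesh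
point is `ε'`-close to `∂D` and `ρ'`-far from both marked points:

* `stub_boundaryDomination : BoundaryDomination` — HÖLDER-WEAK BROWNIAN DOMINATION OF BOUNDARY
  CRAWLING (research-open; the `x_c`-specific input): one pair of constants `C, θ₀ > 0` such that for
  every Dobrushin domain, endpoint approximation, `ρ, ε > 0`, eventually in `δ`,
  `P_δ[near-boundary visit at (ρ, ε)] ≤ C · rwCollarVisit(2ε, ρ/2)^{θ₀}`. Continuum sanity: for
  chordal restriction measures the probability to hit a boundary hull `A` is `1 − Φ'_A^α`, increasing in
  the exponent `α`; SAW has `α = 5/8 < 1 =` the excursion's, so the sharp form holds in the limit with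
  `C = 1, θ₀ = 1` for every simply connected domain at once (LSW03); the slack `(C, θ₀)` absorbs bounded
  lattice-scale boundary factors (Kennedy–Lawler). It is the UNSLIT instance of the Brownian-domination
  inequality of idea card `brownian-domination-simple-limits` / route SAWBrownianDomination
  (`UniformDomination`, stmt-11295, quantifies over slit pasts and arbitrary targets; here: no past, one
  collar target, probabilities averaged under `P_δ` — none of the ring-road / dust witnesses recorded
  against the all-targets form applies, since the complement of a collar in `Ω_δ` is not a ring and
  the target is fat).
* `stub_rwCollarDecay : RWCollarDecay` — THE RANDOM WALK DOES NOT CRAWL (provable potential theory,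
  L–XL): for every `ρ, η > 0` there is `ε > 0` with `rwCollarVisit(2ε, ρ/2) ≤ η` eventually in `δ`.
  Mechanism: the lattice excursion `a_δ → b_δ` converges to the Brownian excursion `a → b` of `D`
  (invariance principle for the `h`-transformed walk; Kozdron 2006 for the excursion limit, Kozdron–Lawler
  2005 / Chelkak–Wan 2021 for Green-function and boundary-Harnack control UNIFORM over simply connected
  lattice domains — exactly the toolbox this route already budgets for `MartinRatioBoundaryLimit` (r7)
  and `RWGreenCrossRatioLimit`), and a Brownian excursion touches `∂D` only at its endpoints, so the
  collar-visit probability is small for small `ε` by continuity from above; the interior-but-converging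
  endpoints allowed by `IsEndpointApprox` are handled by the ratio (Martin) normalisation.

COMPOSITION (PROVED, arithmetic): given `(ρ, θ)`, take `η = (θ/C)^{1/θ₀}`, the `ε` of stub 2, and
chain `P_δ ≤ C·rw^{θ₀} ≤ C·η^{θ₀} = θ` eventually — `LatticeBoundaryDecay_of`.

Why this line on THIS route: SAWExcursionCardy is the SAW × random-walk-excursion route (its
observable is the probability that an independent lattice excursion avoids the walk); comparing the
walk's boundary behaviour with the SAME excursions is its native currency, and the RW half of the line
is the kind of uniform lattice potential theory the route must develop anyway.

Conclusion by name: before the split lands the child is the local `LatticeBoundaryDecay` below (the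
route item text VERBATIM, `Iff.rfl` with `Boundary.Passage.BoundaryDecay`); once
`Theses.SAWExcursionCardy.LatticeBoundaryDecay` exists the last theorem is re-pointed at it (same term).
-/

noncomputable section

open MeasureTheory Filter Topology Set Metric Function Classical
open Literature.Probability.RandomPlanarGeometry Literature.Probability.RandomPlanarGeometry.SAW
open Literature.Probability.LatticeModels
open scoped ENNReal NNReal unitInterval

namespace Summit.CriticalPhenomena.SAWScalingLimit.Cruxes.LatticeBoundaryDecay.DominationBirth

open Summit.CriticalPhenomena.SAWScalingLimit.Theorems.SimpleSubseqLimits.Boundary.Passage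
  (NearBoundaryVisit nearBoundaryVisitEvent BoundaryDecayAt BoundaryDecay)

/-! ### The child (route item text, verbatim) -/

/-- **BOUNDARY child `LatticeBoundaryDecay`** — the route item text verbatim (fully qualified). -/
def LatticeBoundaryDecay : Prop :=
  ∀ (D : Literature.Probability.RandomPlanarGeometry.DobrushinDomain) (a b : ℝ → Literature.Probability.LatticeModels.Site 2), Literature.Probability.RandomPlanarGeometry.SAW.IsEndpointApprox D a b → ∀ ρ θ : ℝ, 0 < ρ → 0 < θ → ∃ ε : ℝ, 0 < ε ∧ ∀ᶠ δ in nhdsWithin 0 (Set.Ioi 0), Literature.Probability.RandomPlanarGeometry.SAW.law D.carrier δ (a δ) (b δ) {γ | ∃ γ' : Literature.Probability.RandomPlanarGeometry.Curve ℂ, Literature.Probability.RandomPlanarGeometry.CurveClass.mk γ' = γ.curve ∧ ∃ t : unitInterval, Metric.infDist (γ' t) (frontier D.carrier) < ε ∧ ρ < dist (γ' t) (D.pt 0) ∧ ρ < dist (γ' t) (D.pt 1)} ≤ ENNReal.ofReal θ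

/-- The child IS `Boundary.Passage.BoundaryDecay` (definitional). -/
theorem latticeBoundaryDecay_iff : LatticeBoundaryDecay ↔ BoundaryDecay := Iff.rfl

/-! ### Random-walk vocabulary: the lattice excursion `u → w` along `Ω_δ`-edges and its visits -/

/-- The walk `j ↦ u + S ω j` moves along `G`-edges up to step `n` and arrives at `w` for the FIRST time
at step `n`. -/
def ArrivesAlong (G : SimpleGraph (Site 2)) (u w : Site 2) (ω : SRW.PathSpace 2) (n : ℕ) : Prop :=
  (∀ j < n, G.Adj (u + SRW.S ω j) (u + SRW.S ω (j + 1))) ∧ u + SRW.S ω n = w ∧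
    ∀ j < n, u + SRW.S ω j ≠ w

/-- `P[SRW from u, run along G-edges, arrives at w]` (the mass of the lattice excursion `u → w`). -/
def rwArrive (G : SimpleGraph (Site 2)) (u w : Site 2) : ℝ :=
  (SRW.pathLaw 2).real {ω | ∃ n, ArrivesAlong G u w ω n}

/-- `P[SRW from u, run along G-edges, arrives at w having visited A on the way (endpoints included)]`. -/
def rwArriveVisit (G : SimpleGraph (Site 2)) (u w : Site 2) (A : Set (Site 2)) : ℝ :=
  (SRW.pathLaw 2).real {ω | ∃ n, ArrivesAlong G u w ω n ∧ ∃ j ≤ n, u + SRW.S ω j ∈ A}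

/-- Visit probability of `A` under the lattice excursion `u → w` of `G` (normalised; junk `0` when the
excursion has mass `0`, which does not happen for joined endpoints). -/
def rwExcursionVisit (G : SimpleGraph (Site 2)) (u w : Site 2) (A : Set (Site 2)) : ℝ :=
  rwArriveVisit G u w A / rwArrive G u w

/-- The lattice COLLAR: sites whose mesh point is `ε`-close to `∂D` and `ρ`-far from both marked
points. -/
def collar (D : DobrushinDomain) (δ ε ρ : ℝ) : Set (Site 2) :=
  {v | infDist (meshPoint δ v) (frontier D.carrier) < ε ∧ ρ < dist (meshPoint δ v) (D.pt 0) ∧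
    ρ < dist (meshPoint δ v) (D.pt 1)}

/-- **The random-walk side of the line**: probability that the lattice excursion `a_δ → b_δ` of `Ω_δ`
visits the `(ε, ρ)`-collar. -/
def rwCollarVisit (D : DobrushinDomain) (δ : ℝ) (u w : Site 2) (ε ρ : ℝ) : ℝ :=
  rwExcursionVisit (discreteDomainGraph D.carrier δ) u w (collar D δ ε ρ)

theorem rwExcursionVisit_nonneg (G : SimpleGraph (Site 2)) (u w : Site 2) (A : Set (Site 2)) :
    0 ≤ rwExcursionVisit G u w A :=
  div_nonneg measureReal_nonneg measureReal_nonneg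

theorem rwCollarVisit_nonneg (D : DobrushinDomain) (δ : ℝ) (u w : Site 2) (ε ρ : ℝ) :
    0 ≤ rwCollarVisit D δ u w ε ρ :=
  rwExcursionVisit_nonneg _ _ _ _

/-! ### The two stubs (the only `sorry`s of this file) -/

/-- **STUB 1 statement — Hölder-weak Brownian domination of boundary crawling** (research-open). -/
def BoundaryDomination : Prop :=
  ∃ C θ₀ : ℝ, 0 < C ∧ 0 < θ₀ ∧
    ∀ (D : DobrushinDomain) (a b : ℝ → Site 2), SAW.IsEndpointApprox D a b →
      ∀ ρ ε : ℝ, 0 < ρ → 0 < ε → ∀ᶠ δ in 𝓝[>] (0 : ℝ),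
        SAW.law D.carrier δ (a δ) (b δ) {γ | γ.curve ∈ nearBoundaryVisitEvent D ρ ε} ≤
          ENNReal.ofReal (C * rwCollarVisit D δ (a δ) (b δ) (2 * ε) (ρ / 2) ^ θ₀)

/-- **STUB 2 statement — the lattice excursion does not crawl** (provable potential theory). -/
def RWCollarDecay : Prop :=
  ∀ (D : DobrushinDomain) (a b : ℝ → Site 2), SAW.IsEndpointApprox D a b →
    ∀ ρ η : ℝ, 0 < ρ → 0 < η → ∃ ε : ℝ, 0 < ε ∧
      ∀ᶠ δ in 𝓝[>] (0 : ℝ), rwCollarVisit D δ (a δ) (b δ) (2 * ε) (ρ / 2) ≤ η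

/-- **STUB 1** (OPEN, `x_c`-specific): Hölder-weak Brownian domination of boundary crawling. -/
theorem stub_boundaryDomination : BoundaryDomination := by
  sorry

/-- **STUB 2** (provable, L–XL): the lattice excursion `a_δ → b_δ` does not crawl along `∂D`. -/
theorem stub_rwCollarDecay : RWCollarDecay := by
  sorry

/-! ### Name-keyed aliases (skeleton audit: hypotheses of the composition are registered stubs) -/
namespace Registered
/-- Alias keyed by the registered stub name. -/
abbrev stub_boundaryDomination : Prop := BoundaryDomination
/-- Alias keyed by the registered stub name. -/
abbrev stub_rwCollarDecay : Prop := RWCollarDecay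
end Registered

/-! ### Composition (PROVED): stubs ⇒ the child, by name -/

/-- Arithmetic of the Hölder-weak seam: with `η = (θ / C)^{1/θ₀}`, `C · η^{θ₀} = θ`. -/
theorem holder_target {C θ₀ θ : ℝ} (hC : 0 < C) (hθ₀ : 0 < θ₀) (hθ : 0 < θ) :
    C * ((θ / C) ^ (1 / θ₀)) ^ θ₀ = θ := by
  rw [← Real.rpow_mul (div_pos hθ hC).le, one_div_mul_cancel hθ₀.ne', Real.rpow_one]
  field_simp

/-- **THE COMPOSITION.** `stub_boundaryDomination → stub_rwCollarDecay → LatticeBoundaryDecay`: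
given `(ρ, θ)` take `η = (θ/C)^{1/θ₀}`, the width `ε` of the random-walk stub, and chain
`P_δ ≤ C · rw^{θ₀} ≤ C · η^{θ₀} = θ` eventually in `δ`. -/
theorem LatticeBoundaryDecay_of (h1 : Registered.stub_boundaryDomination)
    (h2 : Registered.stub_rwCollarDecay) : LatticeBoundaryDecay := by
  rw [latticeBoundaryDecay_iff]
  intro D a b hab ρ θ hρ hθ
  obtain ⟨C, θ₀, hC, hθ₀, hdom⟩ := h1
  have hηpos : 0 < (θ / C) ^ (1 / θ₀) := Real.rpow_pos_of_pos (div_pos hθ hC) _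
  obtain ⟨ε, hε, hrw⟩ := h2 D a b hab ρ ((θ / C) ^ (1 / θ₀)) hρ hηpos
  refine ⟨ε, hε, ?_⟩
  filter_upwards [hdom D a b hab ρ ε hρ hε, hrw] with δ hδ hr
  refine hδ.trans (ENNReal.ofReal_le_ofReal ?_)
  have h0 : 0 ≤ rwCollarVisit D δ (a δ) (b δ) (2 * ε) (ρ / 2) := rwCollarVisit_nonneg ..
  calc C * rwCollarVisit D δ (a δ) (b δ) (2 * ε) (ρ / 2) ^ θ₀
      ≤ C * ((θ / C) ^ (1 / θ₀)) ^ θ₀ := by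
        gcongr
    _ = θ := holder_target hC hθ₀ hθ

/-- Wiring check: the registered stubs feed the composition as stated. -/
example : LatticeBoundaryDecay := LatticeBoundaryDecay_of stub_boundaryDomination stub_rwCollarDecay

/-- The same composition concludes the Theorems-side name of the child. -/
theorem boundaryDecay_of (h1 : Registered.stub_boundaryDomination) (h2 : Registered.stub_rwCollarDecay) :
    BoundaryDecay :=
  latticeBoundaryDecay_iff.1 (LatticeBoundaryDecay_of h1 h2)

end Summit.CriticalPhenomena.SAWScalingLimit.Cruxes.LatticeBoundaryDecay.DominationBirth

end
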